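/-
Copyright (c) 2026 the pub-hodgecm-mathlib formalisation cell (harness21).  Prover seat hodgecm-mathlib-K2E3-p14 (g7), Track B «K2-LIT» ∕ h413
(`stmt-HodgeConjecture-24833`), line `K2_E3_EllipticInputs`, leaf (nsc-S-A′), brick (E4b) = discharge of `h3cell` of ★ E4a, shared tools (E4b-τ), file 3.  2026-09-04.
-/
import Summits.HodgeConjecture.HodgeConjecture.Theorems.K2E3ZeroIntegralCosetAveraging   -- (E4b-τ) file 1 (this seat): transversal sums vs integrals, `avgProj` value formula
import Summits.HodgeConjecture.HodgeConjecture.Theorems.K2E3HaarPushforwardCoset         -- (E4b-τ) file 2 (this seat): push-forward of a Haar probability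
import Literature.NumberTheory.Automorphic.InducedWhittakerVanishing                     -- ★ `SmoothInd.isLocallyConstant_toFun`
import HarnessLib

/-!
# K2_E3 road (h413), leaf (nsc-S-A′), brick (E4b-τ) file 3 — the averaging projector as a Haar integral over a compact open subgroup, and the RELATIVE push-forward
# formula (K2E3-p21 (g7)'s «= with one twist», K2 bus 2026-09-04 12:29:02Z)

Cell `pub/hodgecm-mathlib` (D-0151), Track B, seat K2E3-p14 (g7) (dealer D108); consumers (E4b-1β) K2E3-p21 (g7), (E4b-1γ) K2E3-p25 (g2).  `--supports
stmt-HodgeConjecture-24833 --as helper`; THEOREMS ONLY; GENERIC; COUNT-NEUTRAL.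

* (R2) **`toFun_avgProj_map_subtype_eq_inv_smul_setIntegral`** — for `f ∈ Ind_H^G σ` (`σ` on `ℂ`), a subgroup `U ≤ G` carrying a left-invariant measure `μ_U`
  (finite on compacts, positive on opens) and a compact open subgroup `K ≤ U`:  `(e_K f)(x) = μ_U(K)⁻¹ ∫_{u ∈ K} f(x u) dμ_U(u)` — ★ file 1 `toFun_avgProj_smoothIndRep_eq`
  (transversal sum) + `average_eq_card_inv_smul_sum_of_isLeftTransversal` (transversal sum = Haar average), with the transversal bookkeeping between `K ≤ U` and
  `K.map U.subtype ≤ G` done here once (`isLeftTransversal_map_subtype`).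
* (R1) **`setIntegral_comp_add_eq_smul_setIntegral_vadd`** — for a left-invariant `μ_U` (finite on compacts) on a topological group `U`, a compact subgroup `K ≤ U`,
  `ℓ : U → A` continuous with `ℓ(uv) = ℓ u + ℓ v` and `ℓ(K)` OPEN in the second countable abelian group `A` (add-Haar `μ_A`), and `h` strongly measurable:
  `∫_{u ∈ K} h(y₀ + ℓ u) dμ_U = μ_U(K) · μ_A(ℓ K)⁻¹ · ∫_{y₀ + ℓ(K)} h dμ_A` (★ file 2 `integral_comp_add_eq_inv_smul_setIntegral_vadd` for the normalised restriction
  of `μ_U` to the compact group `K`).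
[BernsteinZelevinsky1977, Thm. 5.2] [Casselman1995, §6.3] [DeitmarEchterhoff2014, Thm. 1.3.4].
HONEST LABEL: HC_CM is proved only modulo the 7 printed citations (2 remaining named inputs: hLiu418 = stmt-HodgeConjecture-24832, h413 = stmt-HodgeConjecture-24833)
until rung 0 closes; count-neutral helper.

## Mathlib ∕ tree search
★ (E4b-τ) files 1–2; ★ `SmoothInd.isLocallyConstant_toFun`; Mathlib `MeasurableEmbedding.subtype_coe ∕ comap_apply ∕ map_comap ∕ integral_map`, `measure_preimage_mul`,
`integral_smul_measure`, `Measure.restrict_eq_zero`, `Finset.sum_map`, `Finset.card_map`, `Complex.real_smul`.  Dedup: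
`rg "avgProj_map_subtype|comp_add_eq_smul_setIntegral"` — no hits.

## References
* [BernsteinZelevinsky1977] I. N. Bernstein, A. V. Zelevinsky, *Induced representations of reductive p-adic groups I*, Ann. Sci. ÉNS 10 (1977), Thm. 5.2.
* [Casselman1995] W. Casselman, *Introduction to the theory of admissible representations of p-adic reductive groups* (draft 1995), §2.1, §6.3.
* [DeitmarEchterhoff2014] A. Deitmar, S. Echterhoff, *Principles of Harmonic Analysis*, 2nd ed. (Springer, 2014), Thm. 1.3.4.
-/

set_option autoImplicit false
set_option linter.dupNamespace false

noncomputable section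

open Function MeasureTheory MeasureTheory.Measure Representation
open scoped Pointwise ENNReal

namespace Summit.HodgeConjecture.HodgeConjecture.Cruxes.H413.K2E3CompactOpenAverageIntegral

open Literature.NumberTheory.Automorphic K2E3ZeroIntegralCosetAveraging K2E3HaarPushforwardCoset

/-! ## §1 Subgroups of a subgroup: transversals and the restricted invariant measure -/

section Subtype

variable {G : Type*} [Group G] (U : Subgroup G)

/-- A left transversal of `K ⁄ (K ∩ T.comap ι)` inside `U` maps to a left transversal of `ι(K) ⁄ (ι(K) ∩ T)` in `G` (`ι = U.subtype`). [folklore] -/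
theorem isLeftTransversal_map_subtype {K : Subgroup U} {T : Subgroup G} {R : Finset U} (hR : IsLeftTransversal K (K ⊓ T.comap U.subtype) R) :
    IsLeftTransversal (K.map U.subtype) (K.map U.subtype ⊓ T) (R.map (Function.Embedding.subtype (· ∈ U))) := by
  refine ⟨fun r hr => ?_, fun x hx => ?_⟩
  · obtain ⟨r', hr', rfl⟩ := Finset.mem_map.1 hr
    exact ⟨r', hR.mem_of_mem r' hr', rfl⟩
  · obtain ⟨k, hk, rfl⟩ := hx
    obtain ⟨r', ⟨hr', hrk⟩, huniq⟩ := hR.existsUnique k hk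
    refine ⟨(r' : G), ⟨Finset.mem_map.2 ⟨r', hr', rfl⟩, ?_⟩, ?_⟩
    · refine ⟨⟨r'⁻¹ * k, hrk.1, rfl⟩, ?_⟩
      exact hrk.2
    · rintro r ⟨hr, hrx⟩
      obtain ⟨r₁, hr₁, rfl⟩ := Finset.mem_map.1 hr
      show (r₁ : G) = (r' : G)
      congr 1
      refine huniq r₁ ⟨hr₁, ⟨?_, ?_⟩⟩
      · obtain ⟨k₁, hk₁, hk₁eq⟩ := hrx.1
        have : k₁ = r₁⁻¹ * k := Subtype.ext hk₁eq
        exact this ▸ hk₁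
      · exact hrx.2

end Subtype

section Comap

variable {U : Type*} [Group U] [TopologicalSpace U] [IsTopologicalGroup U] [MeasurableSpace U] [BorelSpace U]

/-- The restriction of a left-invariant measure on `U` to a subgroup `K ≤ U` (pulled back to the group `K`) is left-invariant. [cite: DeitmarEchterhoff2014, Thm. 1.3.4] -/
theorem isMulLeftInvariant_comap_subtype (μU : Measure U) [μU.IsMulLeftInvariant] (K : Subgroup U) (hKm : MeasurableSet (K : Set U)) :
    (μU.comap ((↑) : K → U)).IsMulLeftInvariant := by
  have hemb : MeasurableEmbedding ((↑) : K → U) := MeasurableEmbedding.subtype_coe hKm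
  refine ⟨fun a => Measure.ext fun B hB => ?_⟩
  rw [Measure.map_apply (measurable_const_mul a) hB, hemb.comap_apply, hemb.comap_apply]
  have hpre : ((↑) : K → U) '' ((fun x : K => a * x) ⁻¹' B) = (fun y : U => (a : U) * y) ⁻¹' (((↑) : K → U) '' B) := by
    ext y
    simp only [Set.mem_image, Set.mem_preimage]
    constructor
    · rintro ⟨x, hx, rfl⟩
      exact ⟨a * x, hx, rfl⟩
    · rintro ⟨z, hz, hzy⟩
      refine ⟨a⁻¹ * z, by rwa [mul_inv_cancel_left], ?_⟩
      rw [Subgroup.coe_mul, Subgroup.coe_inv, hzy, inv_mul_cancel_left]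
  rw [hpre, measure_preimage_mul]

end Comap

/-! ## §2 (R2) The averaging projector as a Haar integral -/

section AvgProj

variable {G : Type*} [Group G] [TopologicalSpace G] [IsTopologicalGroup G] [T2Space G]
  (H : Subgroup G) (σ : Representation ℂ H ℂ) (U : Subgroup G) [MeasurableSpace U] [BorelSpace U]

/-- **(R2) `e_K f` AS A HAAR AVERAGE**: for `f ∈ Ind_H^G σ`, a subgroup `U ≤ G` with a left-invariant measure `μ_U` finite on compacts and positive on opens, and a compact
open subgroup `K ≤ U`: `(e_{K} f)(x) = μ_U(K)⁻¹ · ∫_{u ∈ K} f(x·u) dμ_U(u)` (`e_K` = ★ `Representation.avgProj` for `K.map U.subtype ≤ G`).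
[cite: Casselman1995, §2.1] [cite: BernsteinZelevinsky1977, Thm. 5.2] -/
theorem toFun_avgProj_map_subtype_eq_inv_smul_setIntegral (μU : Measure U) [μU.IsMulLeftInvariant] [IsFiniteMeasureOnCompacts μU] [μU.IsOpenPosMeasure]
    (K : Subgroup U) (hK : IsCompact (K : Set U)) (hKo : IsOpen (K : Set U)) (f : SmoothInd H σ) (x : G) :
    ((smoothIndRep H σ).avgProj (K.map U.subtype) f).toFun x = (μU.real (K : Set U))⁻¹ • ∫ u in (K : Set U), f.toFun (x * (u : G)) ∂μU := by
  classical
  -- the stabiliser of `f` and its trace on `U`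
  set T : Subgroup G := (smoothIndRep H σ).stabilizerSubgroup f with hT
  have hTo : IsOpen (T : Set G) := isSmooth_smoothInd H σ f
  have hT'o : IsOpen ((T.comap U.subtype : Subgroup U) : Set U) := hTo.preimage continuous_subtype_val
  have hTf : ∀ t ∈ T, smoothIndRep H σ t f = f := fun t ht => ((smoothIndRep H σ).mem_stabilizerSubgroup f t).1 ht
  -- a transversal inside `U` and its image in `G`
  obtain ⟨R, hR⟩ := exists_isLeftTransversal (B := K) hK hT'o
  have hRG := isLeftTransversal_map_subtype U hR
  have hKG : IsCompact ((K.map U.subtype : Subgroup G) : Set G) := by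
    rw [Subgroup.coe_map]
    exact hK.image continuous_subtype_val
  -- the transversal formula in `G`
  rw [toFun_avgProj_smoothIndRep_eq H σ f hKG hTo hTf hRG x, Finset.card_map, Finset.sum_map]
  -- the transversal formula in `U` against `μ_U`
  have hΦc : Continuous fun u : U => f.toFun (x * (u : G)) :=
    (Representation.SmoothInd.isLocallyConstant_toFun f).continuous.comp ((continuous_const.mul continuous_subtype_val))
  have hinv : ∀ r ∈ R, ∀ s ∈ K ⊓ T.comap U.subtype, f.toFun (x * ((r * s : U) : G)) = f.toFun (x * (r : G)) := by
    intro r _ s hs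
    have h := congrArg (fun φ : SmoothInd H σ => φ.toFun (x * (r : G))) (hTf (s : G) hs.2)
    simpa only [toFun_smoothIndRep_apply, Subgroup.coe_mul, mul_assoc] using h
  have hKT : IsOpen (((K ⊓ T.comap U.subtype : Subgroup U)) : Set U) := by
    rw [Subgroup.coe_inf]
    exact hKo.inter hT'o
  have hpos : μU.real (((K ⊓ T.comap U.subtype : Subgroup U)) : Set U) ≠ 0 := by
    have h1 : μU (((K ⊓ T.comap U.subtype : Subgroup U)) : Set U) ≠ 0 := (hKT.measure_pos μU ⟨1, Subgroup.one_mem _⟩).ne'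
    have h2 : μU (((K ⊓ T.comap U.subtype : Subgroup U)) : Set U) ≠ ∞ := (measure_mono (show (((K ⊓ T.comap U.subtype : Subgroup U)) : Set U) ⊆ K from
      fun u hu => hu.1)).trans_lt hK.measure_lt_top |>.ne
    exact ENNReal.toReal_ne_zero.2 ⟨h1, h2⟩
  have havg := average_eq_card_inv_smul_sum_of_isLeftTransversal μU hK hT'o hR (hΦc.continuousOn.integrableOn_compact hK) hinv hpos
  rw [havg, Complex.real_smul, Complex.ofReal_inv, Complex.ofReal_natCast]
  rfl

end AvgProj

/-! ## §3 (R1) The relative push-forward formula -/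

section Relative

variable {U : Type*} [Group U] [TopologicalSpace U] [IsTopologicalGroup U] [T2Space U] [MeasurableSpace U] [BorelSpace U]
  {A : Type*} [AddCommGroup A] [TopologicalSpace A] [IsTopologicalAddGroup A] [SecondCountableTopology A] [MeasurableSpace A] [BorelSpace A]
  {E : Type*} [NormedAddCommGroup E] [NormedSpace ℝ E] [CompleteSpace E]

/-- **(R1) RELATIVE PUSH-FORWARD ON COSETS**: `μ_U` left-invariant and finite on compacts, `K ≤ U` a compact subgroup, `ℓ : U → A` continuous with `ℓ(uv) = ℓ u + ℓ v` and
`ℓ(K)` open, `μ_A` an additive Haar measure, `h` strongly measurable: `∫_{u ∈ K} h(y₀ + ℓ u) dμ_U = μ_U(K) · (μ_A(ℓ K)⁻¹ · ∫_{y₀ + ℓ(K)} h dμ_A)`.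
(★ file 2 for the probability measure `μ_U(K)⁻¹ μ_U|^K` on the compact group `K`; both sides vanish if `μ_U(K) = 0`.) [cite: BernsteinZelevinsky1977, Thm. 5.2]
[cite: DeitmarEchterhoff2014, Thm. 1.3.4] -/
theorem setIntegral_comp_add_eq_smul_setIntegral_vadd (μU : Measure U) [μU.IsMulLeftInvariant] [IsFiniteMeasureOnCompacts μU]
    (μA : Measure A) [μA.IsAddHaarMeasure] (ℓ : U → A) (hℓc : Continuous ℓ) (hℓ : ∀ u v, ℓ (u * v) = ℓ u + ℓ v)
    (K : Subgroup U) (hK : IsCompact (K : Set U)) (hKL : IsOpen (ℓ '' (K : Set U))) {h : A → E} (hh : StronglyMeasurable h) (y₀ : A) :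
    ∫ u in (K : Set U), h (y₀ + ℓ u) ∂μU = μU.real (K : Set U) • ((μA.real (ℓ '' (K : Set U)))⁻¹ • ∫ x in y₀ +ᵥ ℓ '' (K : Set U), h x ∂μA) := by
  have hKm : MeasurableSet (K : Set U) := hK.isClosed.measurableSet
  have hKtop : μU (K : Set U) ≠ ∞ := hK.measure_lt_top.ne
  by_cases hK0 : μU (K : Set U) = 0
  · -- both sides vanish
    rw [Measure.restrict_eq_zero.2 hK0, integral_zero_measure, measureReal_def, hK0, ENNReal.toReal_zero, zero_smul]
  -- the compact group `K` with the normalised restriction of `μ_U`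
  haveI : CompactSpace K := isCompact_iff_compactSpace.1 hK
  have hemb : MeasurableEmbedding ((↑) : K → U) := MeasurableEmbedding.subtype_coe hKm
  have hrange : Set.range ((↑) : K → U) = (K : Set U) := by
    ext x
    exact ⟨fun ⟨y, hy⟩ => hy ▸ y.2, fun hx => ⟨⟨x, hx⟩, rfl⟩⟩
  have hr : μU.real (K : Set U) ≠ 0 := ENNReal.toReal_ne_zero.2 ⟨hK0, hKtop⟩
  haveI := isMulLeftInvariant_comap_subtype μU K hKm
  set μS : Measure K := (μU (K : Set U))⁻¹ • μU.comap ((↑) : K → U) with hμS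
  haveI : μS.IsMulLeftInvariant := by rw [hμS]; infer_instance
  haveI : IsProbabilityMeasure μS := ⟨by
    rw [hμS, Measure.smul_apply, hemb.comap_apply, Set.image_univ, hrange, smul_eq_mul, ENNReal.inv_mul_cancel hK0 hKtop]⟩
  have hLo : IsOpen (Set.range fun s : K => ℓ (s : U)) := by
    rw [show (fun s : K => ℓ (s : U)) = ℓ ∘ ((↑) : K → U) from rfl, Set.range_comp, hrange]
    exact hKL
  have key := integral_comp_add_eq_inv_smul_setIntegral_vadd μS μA (fun s : K => ℓ (s : U)) (hℓc.comp continuous_subtype_val) (fun s t => hℓ _ _) hLo hh y₀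
  rw [show (Set.range fun s : K => ℓ (s : U)) = ℓ '' (K : Set U) by
    rw [show (fun s : K => ℓ (s : U)) = ℓ ∘ ((↑) : K → U) from rfl, Set.range_comp, hrange]] at key
  -- the left-hand side of `key` is the normalised set integral over `K`
  have hL : ∫ s, h (y₀ + ℓ (s : U)) ∂μS = (μU.real (K : Set U))⁻¹ • ∫ u in (K : Set U), h (y₀ + ℓ u) ∂μU := by
    have h1 := hemb.integral_map (μ := μU.comap ((↑) : K → U)) (fun u => h (y₀ + ℓ u))
    rw [hemb.map_comap, hrange] at h1
    rw [hμS, integral_smul_measure, ← h1, ENNReal.toReal_inv]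
    rfl
  calc ∫ u in (K : Set U), h (y₀ + ℓ u) ∂μU
      = μU.real (K : Set U) • ((μU.real (K : Set U))⁻¹ • ∫ u in (K : Set U), h (y₀ + ℓ u) ∂μU) := by rw [smul_smul, mul_inv_cancel₀ hr, one_smul]
    _ = μU.real (K : Set U) • ((μA.real (ℓ '' (K : Set U)))⁻¹ • ∫ x in y₀ +ᵥ ℓ '' (K : Set U), h x ∂μA) := by rw [← hL, key]

end Relative

end Summit.HodgeConjecture.HodgeConjecture.Cruxes.H413.K2E3CompactOpenAverageIntegral

end
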